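import Literature.NumberTheory.Automorphic.UnitaryGroupAdelicProduct
import Literature.NumberTheory.Automorphic.UnitaryGroupOfFormAdelicTopology
import Literature.NumberTheory.Automorphic.UnitaryGroupArchTopology
import Mathlib.MeasureTheory.Measure.Haar.Unique
import Mathlib.MeasureTheory.Integral.Prod
import HarnessLib

/-!
# Haar measure on `U(J)(𝔸_F) ≃ U(J)(E ⊗ ℝ) × U(J)(𝔸_{F,f})` is a product: `dh = κ · dh_∞ ⊗ dh_f`, and the
# archimedean / finite factorisation of adelic integrals of factorizable functions

Topic `NumberTheory/Automorphic`; namespaces `Literature.MeasureTheory.Group` (§1, generic) and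
`Literature.NumberTheory.Automorphic.UnitaryGroup` (§§2–3).  KERNEL ONLY: theorems (no definition, no instance, no named
fact), proved from the tree's decomposition `UnitaryGroup.adelicProdEquiv : U(J)(𝔸_F) ≃ₜ* U(J)(E ⊗ ℝ) × U(J)(𝔸_{F,f})`
(`UnitaryGroupAdelicProduct`, [BorelJacquet1979, §4.1] «`G(𝔸) = G_∞ × G(𝔸_f)`») and Mathlib's uniqueness of Haar measure
(`Measure.isMulLeftInvariant_eq_smul`), on the pattern of the tree's `GLn.exists_map_placesSplitting_symm_eq_smul_prod`
(`GLnPlacesSplitting`, [Bump1997, §3.3 Prop. 3.3.2]):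

* §1 (generic) `exists_map_continuousMulEquiv_eq_smul_prod` — for an isomorphism of topological groups `e : G ≃ₜ* G₁ × G₂`
  (second-countable locally compact groups) and Haar measures `ν, μ₁, μ₂`: **`e_* ν = κ · (μ₁ ⊗ μ₂)` for one `κ > 0`**;
  Bochner form `∫_G f dν = κ · ∫_{G₁ × G₂} f(e⁻¹ p) d(μ₁ ⊗ μ₂)` and, for FACTORIZABLE integrands,
  **`∫_G F₁(e(h)₁) F₂(e(h)₂) dν(h) = κ · (∫_{G₁} F₁ dμ₁) · (∫_{G₂} F₂ dμ₂)`** (Fubini, `integral_prod_mul`);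
* §2 the finite-adelic group `U(J)(𝔸_{F,f})` is locally compact, second countable and Hausdorff — read off the CLOSED EMBEDDING
  `finAdelicToAdelic : U(J)(𝔸_{F,f}) → U(J)(𝔸_F)` (continuous, with the continuous retraction `finPart`, image = `ker archPart`)
  and the tree's instances on `U(J)(𝔸_F)` (`UnitaryGroupOfFormAdelicTopology`); stated as theorems, used via `haveI`;
* §3 **`UnitaryGroup.exists_map_adelicProdEquiv_eq_smul_prod`** — for Haar measures `dh` on `U(J)(𝔸_F)`, `dh_∞` on `U(J)(E ⊗ ℝ)`,
  `dh_f` on `U(J)(𝔸_{F,f})`: `(adelicProdEquiv)_* dh = κ · dh_∞ ⊗ dh_f`, `κ > 0`; hence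
  **`UnitaryGroup.exists_integral_archPart_mul_finPart`**: `∫_{U(J)(𝔸)} F₁(h_∞) F₂(h_f) dh = κ · ∫ F₁ dh_∞ · ∫ F₂ dh_f` (one `κ` for
  all `F₁, F₂`) — the group-side half of the `∞ ⊔ f` grouping of [Li1992, Thm 2.1 (27) p. 184] for the source group
  `G' = U(W)(𝔸)` of the theta lift (the function-side half is `Li1992/SchwartzPairingFactorisation`).

## Mathlib / tree search
Tree: `UnitaryGroup.adelicProdEquiv`, `archPart`, `finPart`, `archToAdelic`, `finAdelicToAdelic`, `ker_archPart`
(`UnitaryGroupAdelicProduct`); instances on `UnitaryGroup.adelic` (`UnitaryGroupOfFormAdelicTopology`) and on `UnitaryGroup.arch`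
(`UnitaryGroupArchTopology`); NO second-countability / local compactness of `UnitaryGroup.finAdelic` before this file
(`lean search 'LocallyCompactSpace.*finAdelic'` empty); template `GLn.exists_map_placesSplitting_symm_eq_smul_prod`.
Mathlib: `MulEquiv.isHaarMeasure_map`, `Measure.prod.instIsHaarMeasure`, `Measure.isMulLeftInvariant_eq_smul`,
`haarScalarFactor_pos_of_isHaarMeasure`, `integral_map_equiv`, `integral_prod_mul`, `Topology.IsClosedEmbedding.locallyCompactSpace`.

## References
* [BorelJacquet1979] A. Borel, H. Jacquet, Proc. Symp. Pure Math. 33 (1979), §4.1.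
* [Bump1997] D. Bump, *Automorphic Forms and Representations* (1997), §3.3 Prop. 3.3.2.
* [Li1992] J.-S. Li, J. reine angew. Math. 428 (1992), Thm 2.1 (26)–(27) p. 184.
-/

set_option autoImplicit false

noncomputable section

open _root_.MeasureTheory _root_.MeasureTheory.Measure Topology
open scoped NNReal ENNReal

/-! ## §1 Generic: Haar measure along an isomorphism onto a product of groups -/

namespace Literature.MeasureTheory.Group

variable {G G₁ G₂ : Type*} [Group G] [TopologicalSpace G] [MeasurableSpace G] [BorelSpace G]
  [Group G₁] [TopologicalSpace G₁] [MeasurableSpace G₁] [BorelSpace G₁]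
  [Group G₂] [TopologicalSpace G₂] [MeasurableSpace G₂] [BorelSpace G₂]

/-- **Haar measure transported along `e : G ≃ₜ* G₁ × G₂` is a positive multiple of the product of Haar measures**:
`e_* ν = κ · (μ₁ ⊗ μ₂)`, `κ > 0` (the image is a Haar measure on the second-countable locally compact group `G₁ × G₂`, and so is
`μ₁ ⊗ μ₂`; uniqueness). [cite: Bump1997, §3.3 Prop. 3.3.2] -/
theorem exists_map_continuousMulEquiv_eq_smul_prod [IsTopologicalGroup G] [IsTopologicalGroup G₁] [IsTopologicalGroup G₂]
    [SecondCountableTopology G₁] [LocallyCompactSpace G₁] [SecondCountableTopology G₂] [LocallyCompactSpace G₂]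
    (e : G ≃ₜ* G₁ × G₂) (ν : Measure G) [ν.IsHaarMeasure]
    (μ₁ : Measure G₁) [μ₁.IsHaarMeasure] (μ₂ : Measure G₂) [μ₂.IsHaarMeasure] :
    ∃ κ : ℝ≥0, 0 < κ ∧ ν.map e = κ • μ₁.prod μ₂ := by
  haveI : BorelSpace (G₁ × G₂) := Prod.borelSpace
  haveI : SigmaCompactSpace G₁ := sigmaCompactSpace_of_locallyCompact_secondCountable
  haveI : SigmaCompactSpace G₂ := sigmaCompactSpace_of_locallyCompact_secondCountable
  haveI : SigmaFinite μ₁ := inferInstance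
  haveI : SigmaFinite μ₂ := inferInstance
  haveI : (μ₁.prod μ₂).IsHaarMeasure := inferInstance
  haveI : (ν.map e).IsHaarMeasure := e.toMulEquiv.isHaarMeasure_map ν e.continuous e.symm.continuous
  exact ⟨(ν.map e).haarScalarFactor (μ₁.prod μ₂), haarScalarFactor_pos_of_isHaarMeasure _ _,
    isMulLeftInvariant_eq_smul (ν.map e) (μ₁.prod μ₂)⟩

/-- **Bochner form**: if `e_* ν = κ · (μ₁ ⊗ μ₂)` then `∫_G f dν = κ · ∫_{G₁ × G₂} f(e⁻¹ p) d(μ₁ ⊗ μ₂)` for every `f`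
(transport along the measurable equivalence underlying `e`). [cite: Bump1997, §3.3 Prop. 3.3.2] -/
theorem integral_eq_smul_integral_prod_of_map_eq [SecondCountableTopologyEither G₁ G₂] {e : G ≃ₜ* G₁ × G₂} {ν : Measure G}
    {μ₁ : Measure G₁} {μ₂ : Measure G₂} {κ : ℝ≥0} (h : ν.map e = κ • μ₁.prod μ₂) {𝕜 : Type*} [NormedAddCommGroup 𝕜]
    [NormedSpace ℝ 𝕜] (f : G → 𝕜) : ∫ x, f x ∂ν = (κ : ℝ) • ∫ p, f (e.symm p) ∂(μ₁.prod μ₂) := by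
  haveI : BorelSpace (G₁ × G₂) := Prod.borelSpace
  have hcoe : (e.toHomeomorph.toMeasurableEquiv : G → G₁ × G₂) = e := Homeomorph.toMeasurableEquiv_coe _
  have h1 : ∫ p, f (e.symm p) ∂(ν.map e) = ∫ x, f x ∂ν := by
    rw [← hcoe, integral_map_equiv]
    refine integral_congr_ae (Filter.Eventually.of_forall fun x => ?_)
    simp only [hcoe, ContinuousMulEquiv.symm_apply_apply]
  rw [← h1, h, integral_smul_nnreal_measure, NNReal.smul_def]

/-- **Factorizable integrands**: if `e_* ν = κ · (μ₁ ⊗ μ₂)` then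
`∫_G F₁(e(h)₁) · F₂(e(h)₂) dν(h) = κ · (∫_{G₁} F₁ dμ₁) · (∫_{G₂} F₂ dμ₂)` (Fubini; by Mathlib's convention both sides vanish
together when a factor is not integrable). [cite: Bump1997, §3.3 Prop. 3.3.2] -/
theorem integral_mul_eq_of_map_eq [SecondCountableTopologyEither G₁ G₂] {e : G ≃ₜ* G₁ × G₂} {ν : Measure G}
    {μ₁ : Measure G₁} {μ₂ : Measure G₂} {κ : ℝ≥0} (h : ν.map e = κ • μ₁.prod μ₂) [SFinite μ₁] [SFinite μ₂] {𝕜 : Type*}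
    [RCLike 𝕜] (F₁ : G₁ → 𝕜) (F₂ : G₂ → 𝕜) :
    ∫ x, F₁ (e x).1 * F₂ (e x).2 ∂ν = ((κ : ℝ) : 𝕜) * ((∫ a, F₁ a ∂μ₁) * ∫ b, F₂ b ∂μ₂) := by
  rw [integral_eq_smul_integral_prod_of_map_eq h]
  simp only [ContinuousMulEquiv.apply_symm_apply]
  rw [integral_prod_mul, RCLike.real_smul_eq_coe_mul]

end Literature.MeasureTheory.Group

/-! ## §2 `U(J)(𝔸_{F,f})` is locally compact, second countable, Hausdorff (closed embedding into `U(J)(𝔸_F)`) -/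

namespace Literature.NumberTheory.Automorphic.UnitaryGroup

open NumberField Literature.MeasureTheory.Group

variable (F E : Type) [Field F] [NumberField F] [Field E] [NumberField E] [Algebra F E]
  (c : E ≃ₐ[F] E) (N : ℕ) (J : Matrix (Fin N) (Fin N) E)

/-- **`finAdelicToAdelic : U(J)(𝔸_{F,f}) → U(J)(𝔸_F)` is a closed embedding** (continuous, with the continuous retraction
`finPart`, into a Hausdorff group). [cite: BorelJacquet1979, §4.1] -/
theorem isClosedEmbedding_finAdelicToAdelic : IsClosedEmbedding (finAdelicToAdelic F E c N J) := by
  haveI : T2Space (adelicGroupData F E c N J).Adelic := inferInstanceAs (T2Space (adelic F E c N J))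
  exact Function.LeftInverse.isClosedEmbedding (f := finPart F E c N J) (g := finAdelicToAdelic F E c N J)
    (finPart_finAdelicToAdelic F E c N J) (continuous_finPart F E c N J) (continuous_finAdelicToAdelic F E c N J)

/-- **`U(J)(𝔸_{F,f})` is locally compact.** [cite: BorelJacquet1979, §4.1] [cite: PlatonovRapinchuk1994, §5.1] -/
theorem locallyCompactSpace_finAdelic : LocallyCompactSpace (finAdelic F E c N J) := by
  haveI : LocallyCompactSpace (adelicGroupData F E c N J).Adelic := inferInstanceAs (LocallyCompactSpace (adelic F E c N J))
  exact (isClosedEmbedding_finAdelicToAdelic F E c N J).locallyCompactSpace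

/-- **`U(J)(𝔸_{F,f})` is second countable.** [cite: BorelJacquet1979, §4.1] -/
theorem secondCountableTopology_finAdelic : SecondCountableTopology (finAdelic F E c N J) := by
  haveI : SecondCountableTopology (adelicGroupData F E c N J).Adelic :=
    inferInstanceAs (SecondCountableTopology (adelic F E c N J))
  exact (isClosedEmbedding_finAdelicToAdelic F E c N J).isEmbedding.secondCountableTopology

/-- **`U(J)(𝔸_{F,f})` is Hausdorff.** [cite: BorelJacquet1979, §4.1] -/
theorem t2Space_finAdelic : T2Space (finAdelic F E c N J) := by
  haveI : T2Space (adelicGroupData F E c N J).Adelic := inferInstanceAs (T2Space (adelic F E c N J))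
  exact (isClosedEmbedding_finAdelicToAdelic F E c N J).isEmbedding.t2Space

/-! ## §3 Haar measure on `U(J)(𝔸_F)` is `κ · dh_∞ ⊗ dh_f` -/

section Haar

variable [MeasurableSpace (adelic F E c N J)] [MeasurableSpace (arch F E c N J)] [MeasurableSpace (finAdelic F E c N J)]
  (ν : Measure (adelic F E c N J)) (μa : Measure (arch F E c N J)) (μf : Measure (finAdelic F E c N J))

/-- **`(adelicProdEquiv)_* dh = κ · dh_∞ ⊗ dh_f`** for Haar measures `dh` on `U(J)(𝔸_F)`, `dh_∞` on `U(J)(E ⊗ ℝ)` and `dh_f` on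
`U(J)(𝔸_{F,f})`, with one `κ > 0`. [cite: BorelJacquet1979, §4.1] [cite: Bump1997, §3.3 Prop. 3.3.2] -/
theorem exists_map_adelicProdEquiv_eq_smul_prod [BorelSpace (adelic F E c N J)] [BorelSpace (arch F E c N J)]
    [BorelSpace (finAdelic F E c N J)] [ν.IsHaarMeasure] [μa.IsHaarMeasure] [μf.IsHaarMeasure] :
    ∃ κ : ℝ≥0, 0 < κ ∧ Measure.map (α := adelic F E c N J) (adelicProdEquiv F E c N J) ν = κ • μa.prod μf := by
  haveI := locallyCompactSpace_finAdelic F E c N J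
  haveI := secondCountableTopology_finAdelic F E c N J
  -- `adelicProdEquiv` re-read on the subgroup type `↥(adelic …)` (its carrier `(adelicGroupData …).Adelic` is this type by `rfl`,
  -- but instance search does not unfold the datum), so that the Borel / Haar instances in scope apply
  let e : adelic F E c N J ≃ₜ* arch F E c N J × finAdelic F E c N J := { adelicProdEquiv F E c N J with }
  exact exists_map_continuousMulEquiv_eq_smul_prod e ν μa μf

omit [MeasurableSpace (adelic F E c N J)] [MeasurableSpace (arch F E c N J)] in
/-- `dh_f` is s-finite (σ-finite: `U(J)(𝔸_{F,f})` is σ-compact, being locally compact and second countable). [cite: BorelJacquet1979, §4.1] -/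
theorem sFinite_haar_finAdelic [BorelSpace (finAdelic F E c N J)] [μf.IsHaarMeasure] : SFinite μf := by
  haveI := locallyCompactSpace_finAdelic F E c N J
  haveI := secondCountableTopology_finAdelic F E c N J
  haveI : SigmaCompactSpace (finAdelic F E c N J) := sigmaCompactSpace_of_locallyCompact_secondCountable
  haveI : SigmaFinite μf := inferInstance
  infer_instance

/-- **`∫_{U(J)(𝔸_F)} f dh = κ · ∫ f((a, 1)·(1, b)) d(dh_∞ ⊗ dh_f)(a, b)`** for every `f`, with the `κ` of
`exists_map_adelicProdEquiv_eq_smul_prod`. [cite: BorelJacquet1979, §4.1] [cite: Bump1997, §3.3 Prop. 3.3.2] -/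
theorem exists_integral_eq_smul_integral_adelicProdEquiv [BorelSpace (adelic F E c N J)] [BorelSpace (arch F E c N J)]
    [BorelSpace (finAdelic F E c N J)] [ν.IsHaarMeasure] [μa.IsHaarMeasure] [μf.IsHaarMeasure] :
    ∃ κ : ℝ≥0, 0 < κ ∧ ∀ {𝕜 : Type} [NormedAddCommGroup 𝕜] [NormedSpace ℝ 𝕜] (f : adelic F E c N J → 𝕜),
      ∫ x, f x ∂ν = (κ : ℝ) • ∫ p, f (archToAdelic F E c N J p.1 * finAdelicToAdelic F E c N J p.2) ∂(μa.prod μf) := by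
  obtain ⟨κ, hκ, h⟩ := exists_map_adelicProdEquiv_eq_smul_prod F E c N J ν μa μf
  let e : adelic F E c N J ≃ₜ* arch F E c N J × finAdelic F E c N J := { adelicProdEquiv F E c N J with }
  exact ⟨κ, hκ, fun f => integral_eq_smul_integral_prod_of_map_eq (e := e) h f⟩

/-- **The `∞ ⊔ f` factorisation of adelic integrals of factorizable functions on `U(J)(𝔸_F)`**:
`∫_{U(J)(𝔸_F)} F₁(h_∞) · F₂(h_f) dh = κ · (∫_{U(J)(E ⊗ ℝ)} F₁ dh_∞) · (∫_{U(J)(𝔸_{F,f})} F₂ dh_f)`, one `κ > 0` for all `F₁, F₂`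
(`h_∞ = archPart h`, `h_f = finPart h`) — for `U(J) = U(W)`, the source group of the theta lift, this is the group-side half
of grouping the places of [Li1992, (27)] as `∞ ⊔ f`. [cite: Li1992, Thm 2.1 (27) p. 184] [cite: Bump1997, §3.3 Prop. 3.3.2] -/
theorem exists_integral_archPart_mul_finPart [BorelSpace (adelic F E c N J)] [BorelSpace (arch F E c N J)]
    [BorelSpace (finAdelic F E c N J)] [ν.IsHaarMeasure] [μa.IsHaarMeasure] [μf.IsHaarMeasure] :
    ∃ κ : ℝ≥0, 0 < κ ∧ ∀ {𝕜 : Type} [RCLike 𝕜] (F₁ : arch F E c N J → 𝕜) (F₂ : finAdelic F E c N J → 𝕜),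
      ∫ h, F₁ (archPart F E c N J h) * F₂ (finPart F E c N J h) ∂ν = ((κ : ℝ) : 𝕜) * ((∫ a, F₁ a ∂μa) * ∫ b, F₂ b ∂μf) := by
  obtain ⟨κ, hκ, h⟩ := exists_map_adelicProdEquiv_eq_smul_prod F E c N J ν μa μf
  haveI := sFinite_haar_finAdelic F E c N J μf
  let e : adelic F E c N J ≃ₜ* arch F E c N J × finAdelic F E c N J := { adelicProdEquiv F E c N J with }
  exact ⟨κ, hκ, fun F₁ F₂ => integral_mul_eq_of_map_eq (e := e) h F₁ F₂⟩

end Haar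

end Literature.NumberTheory.Automorphic.UnitaryGroup

end
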